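import Literature.MathematicalPhysics.QuantumLattice.HubbardMatsubaraShellGrid
import Literature.MathematicalPhysics.QuantumLattice.HubbardCTWeightedDetBound
import HarnessLib

/-!
# The INTERPOLATED two-cutoff grid covariance `C_g + t·S_g` is a weighted normal covariance: `M`-uniform determinant / Gram bound
# along the whole interpolation (de Siqueira Pedra–Salmhofer 2008, Thm 1.3), and its row sums

Topic `MathematicalPhysics/QuantumLattice`; continuation of `HubbardMatsubaraShellGrid` (`S″ᵀ·C″^K_{>Λ}·S″ = Sᵀ·C^K_{>Λ}·S + S″ᵀ·S_shell·S″` on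
any grid: cutoffs `M ≤ M″` of the Hubbard torus in a counterterm frame `K`) and `HubbardCTWeightedDetBound` (the `M`-uniform grid-chronological
determinant bound for a normal covariance with ANY weight `v ≤ 1`).  Cell gate-hubbard-kl, crux K3, engine item `KLRegimeEngineV16`, stub
`stub_twoLeg_scale0`, the CUTOFF leg of (E3f-AT)₀: the covariance-response step `effAction (C_g + S_g) W − effAction C_g W`
(`…Theorems.KLProgrammeKLRegimeTwoCutoffResponseStep`) reads kernel data of the interpolated actions `𝒱_t = effAction (C_g + t·S_g) W`,
`t ∈ [0,1]`, hence needs the Gram-boundedness of `C_g + t·S_g` UNIFORMLY in `t` — supplied here with no Gram FORM of `C_g`: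

* **`gridSub_hubbardCovAboveCT_add_smul_shell_eq`** — on the `4M″` grid, at zero seed,
  `Sᵀ C^K_{>Λ} S + t·(S″ᵀ S_shell S″) = S″ᵀ · normalCovariance L M″ (v_t · βL²(iω + e_K)/(ω² + e_K²)) · S″` with the weight
  `v_t(k) = w^K_Λ(k)·(t on the shell, 1 on the window)` (`∈ [0,1]` for `t ∈ [0,1]`);
* **`isDetBoundedR_gridSub_twoCutoff`** / **`isGramBoundedR_gridSub_twoCutoff`** — for `0 < β`, `0 ≤ t ≤ 1` and any `κ` bounding the infrared
  constant `(βL²)⁻¹Σ(1 − w^K_Λ)/√(ω² + e_K²)` of the cutoff-`M″` weight: `IsDetBoundedR q (C_g + t·S_g) √(2(7 + κ² + 2(M″−M)/(π(2M+1))))`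
  (the shell costs its Fourier–Gram sum `Σ_shell 1/|ω| ≤ 2(M″−M)β/(π(2M+1))`, `HubbardMatsubaraShellSums.sum_shell_one_div_abs_le`; `< 1/π` for a
  dyadic shell), uniformly in `t`, `M`, `M″`, `L`, `β`;
* `sum_norm_add_real_smul_row_le` / `…_col_le` — row/column sums of `C + t·D` from those of `C` and `D` (bookkeeping for the same consumer).

Everything is PROVED; no definitions, no named facts.

## Sources

W. de Siqueira Pedra, M. Salmhofer, Comm. Math. Phys. 282 (2008) 797–818, Thm 1.3, §5 Lemma 5.1 [`PedraSalmhofer2008`];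
M. Salmhofer, *Renormalization* (1999), §4.2.5 (4.70), App. B.2 (B.23)–(B.25) [`Salmhofer1999`].
-/

noncomputable section

open Finset

open scoped InnerProductSpace ComplexConjugate

namespace Literature.MathematicalPhysics.QuantumLattice

open Literature.Probability.LatticeModels GrassmannAlgebra

variable {L : ℕ} [NeZero L] {M M'' : ℕ}

/-! ### §0 Bookkeeping: row and column sums along a real interpolation -/

section RowSums

variable {Γ : Type*} [Fintype Γ]

/-- Row sums of `C + t·D` (`0 ≤ t`): `Σ_Y ‖(C + t·D) X Y‖ ≤ a + t·b` (the decay constant `α` of an interpolated covariance). [cite: BenfattoGiulianiMastropietro2006, §2.8 (2.80)] -/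
theorem sum_norm_add_real_smul_row_le (C D : Matrix Γ Γ ℂ) {t a b : ℝ} (ht : 0 ≤ t) (hC : ∀ X, ∑ Y, ‖C X Y‖ ≤ a)
    (hD : ∀ X, ∑ Y, ‖D X Y‖ ≤ b) (X : Γ) : ∑ Y, ‖(C + t • D) X Y‖ ≤ a + t * b := by
  calc ∑ Y, ‖(C + t • D) X Y‖ ≤ ∑ Y, (‖C X Y‖ + t * ‖D X Y‖) := sum_le_sum fun Y _ => by
          rw [Matrix.add_apply, Matrix.smul_apply, Complex.real_smul]
          refine (norm_add_le _ _).trans ?_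
          rw [norm_mul, Complex.norm_real, Real.norm_eq_abs, abs_of_nonneg ht]
    _ = ∑ Y, ‖C X Y‖ + t * ∑ Y, ‖D X Y‖ := by rw [sum_add_distrib, mul_sum]
    _ ≤ a + t * b := add_le_add (hC X) (mul_le_mul_of_nonneg_left (hD X) ht)

/-- Column sums of `C + t·D` (`0 ≤ t`): `Σ_X ‖(C + t·D) X Y‖ ≤ a + t·b` (the decay constant `α` of an interpolated covariance). [cite: BenfattoGiulianiMastropietro2006, §2.8 (2.80)] -/
theorem sum_norm_add_real_smul_col_le (C D : Matrix Γ Γ ℂ) {t a b : ℝ} (ht : 0 ≤ t) (hC : ∀ Y, ∑ X, ‖C X Y‖ ≤ a)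
    (hD : ∀ Y, ∑ X, ‖D X Y‖ ≤ b) (Y : Γ) : ∑ X, ‖(C + t • D) X Y‖ ≤ a + t * b := by
  calc ∑ X, ‖(C + t • D) X Y‖ ≤ ∑ X, (‖C X Y‖ + t * ‖D X Y‖) := sum_le_sum fun X _ => by
          rw [Matrix.add_apply, Matrix.smul_apply, Complex.real_smul]
          refine (norm_add_le _ _).trans ?_
          rw [norm_mul, Complex.norm_real, Real.norm_eq_abs, abs_of_nonneg ht]
    _ = ∑ X, ‖C X Y‖ + t * ∑ X, ‖D X Y‖ := by rw [sum_add_distrib, mul_sum]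
    _ ≤ a + t * b := add_le_add (hC Y) (mul_le_mul_of_nonneg_left (hD Y) ht)

/-- Row sums of `C − D`: `Σ_Y ‖(C − D) X Y‖ ≤ a + b` (the decay constant `α` of a difference covariance). [cite: BenfattoGiulianiMastropietro2006, §2.8 (2.80)] -/
theorem sum_norm_sub_row_le (C D : Matrix Γ Γ ℂ) {a b : ℝ} (hC : ∀ X, ∑ Y, ‖C X Y‖ ≤ a) (hD : ∀ X, ∑ Y, ‖D X Y‖ ≤ b) (X : Γ) :
    ∑ Y, ‖(C - D) X Y‖ ≤ a + b := by
  calc ∑ Y, ‖(C - D) X Y‖ ≤ ∑ Y, (‖C X Y‖ + ‖D X Y‖) := sum_le_sum fun Y _ => by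
          rw [Matrix.sub_apply]; exact norm_sub_le _ _
    _ = ∑ Y, ‖C X Y‖ + ∑ Y, ‖D X Y‖ := sum_add_distrib
    _ ≤ a + b := add_le_add (hC X) (hD X)

/-- Column sums of `C − D`: `Σ_X ‖(C − D) X Y‖ ≤ a + b` (the decay constant `α` of a difference covariance). [cite: BenfattoGiulianiMastropietro2006, §2.8 (2.80)] -/
theorem sum_norm_sub_col_le (C D : Matrix Γ Γ ℂ) {a b : ℝ} (hC : ∀ Y, ∑ X, ‖C X Y‖ ≤ a) (hD : ∀ Y, ∑ X, ‖D X Y‖ ≤ b) (Y : Γ) :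
    ∑ X, ‖(C - D) X Y‖ ≤ a + b := by
  calc ∑ X, ‖(C - D) X Y‖ ≤ ∑ X, (‖C X Y‖ + ‖D X Y‖) := sum_le_sum fun X _ => by
          rw [Matrix.sub_apply]; exact norm_sub_le _ _
    _ = ∑ X, ‖C X Y‖ + ∑ X, ‖D X Y‖ := sum_add_distrib
    _ ≤ a + b := add_le_add (hC Y) (hD Y)

end RowSums

/-! ### §1 The normal form of the interpolated two-cutoff covariance -/

section NormalForm

omit [NeZero L] in
/-- Scaling the symbol by a constant scales the normal covariance. [cite: BenfattoGiulianiMastropietro2006, §2.1 (2.3)] -/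
theorem normalCovariance_const_mul_symbol (c : ℂ) (p : FreqMomentum L M × Fin 2 → ℂ) :
    normalCovariance L M (fun ks => c * p ks) = c • normalCovariance L M p := by
  ext X Y
  rw [Matrix.smul_apply, smul_eq_mul, normalCovariance_smul_symbol (fun _ => c) p X Y]

/-- **The symbol of `C″^K_{>Λ} − (1 − t)·S_shell` is the weighted symbol** `v_t · βL²(iω + e_K)/(ω² + e_K²)`, `v_t = w^K_Λ·(t on the shell, 1 on the
window)`. [cite: PedraSalmhofer2008, §5 Lemma 5.1] -/
theorem uvSymbolCT_sub_smul_shellSymbolCT_eq (h : M ≤ M'') (β μ : ℝ) (K : TrigPolyC4v) (Λ : ℝ) (t : ℝ) (ks : FreqMomentum L M'' × Fin 2) :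
    uvSymbolCT L M'' β μ K Λ ks - ((1 - t : ℝ) : ℂ) * shellSymbolCT L h β μ K Λ ks =
      ((hubbardCutoffWeightCT L M'' β μ K Λ ks.1 * (if ks.1.1 ∈ MatsubaraIdx.shell h then t else 1) : ℝ) : ℂ) *
        (((β * (L : ℝ) ^ 2 : ℝ) : ℂ) *
          ((Complex.I * matsubaraFreq β M'' ks.1.1 + nambuXiCT L μ K ks.1.2) / nambuDenCT L M'' β μ 0 K ks.1)) := by
  by_cases hk : ks.1.1 ∈ MatsubaraIdx.shell h
  · rw [shellSymbolCT_of_mem h β μ K Λ hk, if_pos hk, uvSymbolCT]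
    push_cast
    ring
  · rw [shellSymbolCT_of_not_mem h β μ K Λ hk, if_neg hk, uvSymbolCT]
    push_cast
    ring

/-- **The interpolated two-cutoff grid covariance is a pulled-back weighted normal covariance** (zero seed, cutoffs `M ≤ M″`, the `4M″` grid,
any real `t`): `Sᵀ C^K_{>Λ} S + t·(S″ᵀ S_shell S″) = S″ᵀ · normalCovariance L M″ (v_t · βL²(iω + e_K)/(ω² + e_K²)) · S″`,
`v_t = w^K_Λ·(t on the shell, 1 on the window)` — from `S″ᵀC″S″ = SᵀCS + S″ᵀS_shellS″` and the normal forms of `C″^K_{>Λ}` and `S_shell`.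
[cite: Salmhofer1999, App. B.2 (B.23)-(B.25)] -/
theorem gridSub_hubbardCovAboveCT_add_smul_shell_eq (h : M ≤ M'') (β μ : ℝ) (K : TrigPolyC4v) (Λ : ℝ) (t : ℝ) :
    (hubbardGridSub L M β (2 * (2 * M''))).transpose * hubbardCovAboveCT L M β μ 0 K Λ * hubbardGridSub L M β (2 * (2 * M'')) +
        t • ((hubbardGridSub L M'' β (2 * (2 * M''))).transpose * hubbardCovShellCT L h β μ 0 K Λ *
          hubbardGridSub L M'' β (2 * (2 * M''))) =
      (hubbardGridSub L M'' β (2 * (2 * M''))).transpose *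
        normalCovariance L M'' (fun ks =>
          ((hubbardCutoffWeightCT L M'' β μ K Λ ks.1 * (if ks.1.1 ∈ MatsubaraIdx.shell h then t else 1) : ℝ) : ℂ) *
            (((β * (L : ℝ) ^ 2 : ℝ) : ℂ) *
              ((Complex.I * matsubaraFreq β M'' ks.1.1 + nambuXiCT L μ K ks.1.2) / nambuDenCT L M'' β μ 0 K ks.1))) *
        hubbardGridSub L M'' β (2 * (2 * M'')) := by
  set S'' := hubbardGridSub L M'' β (2 * (2 * M'')) with hS''
  set S := hubbardGridSub L M β (2 * (2 * M'')) with hS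
  have hadd : S''.transpose * hubbardCovAboveCT L M'' β μ 0 K Λ * S'' =
      S.transpose * hubbardCovAboveCT L M β μ 0 K Λ * S + S''.transpose * hubbardCovShellCT L h β μ 0 K Λ * S'' := by
    simp only [hS'', hS, hubbardGridSub]
    exact gridSub_hubbardCovAboveCT_eq_add_shell h β μ 0 K Λ _ _
  have hCg : S.transpose * hubbardCovAboveCT L M β μ 0 K Λ * S =
      S''.transpose * hubbardCovAboveCT L M'' β μ 0 K Λ * S'' - S''.transpose * hubbardCovShellCT L h β μ 0 K Λ * S'' :=
    eq_sub_of_add_eq hadd.symm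
  -- the symbol identity
  have hsym : (fun ks => ((hubbardCutoffWeightCT L M'' β μ K Λ ks.1 * (if ks.1.1 ∈ MatsubaraIdx.shell h then t else 1) : ℝ) : ℂ) *
        (((β * (L : ℝ) ^ 2 : ℝ) : ℂ) *
          ((Complex.I * matsubaraFreq β M'' ks.1.1 + nambuXiCT L μ K ks.1.2) / nambuDenCT L M'' β μ 0 K ks.1))) =
      fun ks => uvSymbolCT L M'' β μ K Λ ks - ((1 - t : ℝ) : ℂ) * shellSymbolCT L h β μ K Λ ks := by
    funext ks
    exact (uvSymbolCT_sub_smul_shellSymbolCT_eq h β μ K Λ t ks).symm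
  have hcov : normalCovariance L M'' (fun ks =>
        ((hubbardCutoffWeightCT L M'' β μ K Λ ks.1 * (if ks.1.1 ∈ MatsubaraIdx.shell h then t else 1) : ℝ) : ℂ) *
          (((β * (L : ℝ) ^ 2 : ℝ) : ℂ) *
            ((Complex.I * matsubaraFreq β M'' ks.1.1 + nambuXiCT L μ K ks.1.2) / nambuDenCT L M'' β μ 0 K ks.1))) =
      hubbardCovAboveCT L M'' β μ 0 K Λ - ((1 - t : ℝ) : ℂ) • hubbardCovShellCT L h β μ 0 K Λ := by
    rw [hsym, normalCovariance_sub_symbol, normalCovariance_const_mul_symbol, hubbardCovShellCT_zero_seed,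
      hubbardCovAboveCT_zero_seed_eq_normalCovariance_uvSymbolCT]
  have hreal : t • (S''.transpose * hubbardCovShellCT L h β μ 0 K Λ * S'') =
      (t : ℂ) • (S''.transpose * hubbardCovShellCT L h β μ 0 K Λ * S'') := by
    ext X Y
    rw [Matrix.smul_apply, Matrix.smul_apply, Complex.real_smul, smul_eq_mul]
  rw [hcov, hreal, hCg, Matrix.mul_sub, Matrix.sub_mul, Matrix.mul_smul, Matrix.smul_mul]
  have h1t : ((1 - t : ℝ) : ℂ) = 1 - (t : ℂ) := by push_cast; ring
  rw [h1t, sub_smul, one_smul]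
  abel

/-- **The cutoff-`M` covariance on the `4M″` grid is the cutoff-`M″` one minus the shell**: `Sᵀ C^K_{>Λ} S = S″ᵀ C″^K_{>Λ} S″ − S″ᵀ S_shell S″`
(`HubbardMatsubaraShellGrid.gridSub_hubbardCovAboveCT_eq_add_shell` read backwards; any seed). [cite: Salmhofer1999, App. B.2 (B.23)-(B.25)] -/
theorem gridSub_hubbardCovAboveCT_eq_sub_shell (h : M ≤ M'') (β μ hs : ℝ) (K : TrigPolyC4v) (Λ : ℝ) :
    (hubbardGridSub L M β (2 * (2 * M''))).transpose * hubbardCovAboveCT L M β μ hs K Λ * hubbardGridSub L M β (2 * (2 * M'')) =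
      (hubbardGridSub L M'' β (2 * (2 * M''))).transpose * hubbardCovAboveCT L M'' β μ hs K Λ * hubbardGridSub L M'' β (2 * (2 * M'')) -
        (hubbardGridSub L M'' β (2 * (2 * M''))).transpose * hubbardCovShellCT L h β μ hs K Λ * hubbardGridSub L M'' β (2 * (2 * M'')) := by
  simp only [hubbardGridSub]
  exact eq_sub_of_add_eq (gridSub_hubbardCovAboveCT_eq_add_shell h β μ hs K Λ _ _).symm

/-- Row sums of the cutoff-`M` covariance on the `4M″` grid from those of the cutoff-`M″` covariance and of the shell (`≤ a″ + a_S`). [cite: BenfattoGiulianiMastropietro2006, §2.8 (2.80)] -/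
theorem rowSum_gridSub_hubbardCovAboveCT_le_of_shell (h : M ≤ M'') (β μ hs : ℝ) (K : TrigPolyC4v) (Λ : ℝ) {a b : ℝ}
    (hC : ∀ X, ∑ Y, ‖((hubbardGridSub L M'' β (2 * (2 * M''))).transpose * hubbardCovAboveCT L M'' β μ hs K Λ *
      hubbardGridSub L M'' β (2 * (2 * M''))) X Y‖ ≤ a)
    (hS : ∀ X, ∑ Y, ‖((hubbardGridSub L M'' β (2 * (2 * M''))).transpose * hubbardCovShellCT L h β μ hs K Λ *
      hubbardGridSub L M'' β (2 * (2 * M''))) X Y‖ ≤ b)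
    (X : GridLeg (GridPoint L (2 * (2 * M'')))) :
    ∑ Y, ‖((hubbardGridSub L M β (2 * (2 * M''))).transpose * hubbardCovAboveCT L M β μ hs K Λ * hubbardGridSub L M β (2 * (2 * M''))) X Y‖ ≤
      a + b := by
  rw [gridSub_hubbardCovAboveCT_eq_sub_shell h β μ hs K Λ]
  exact sum_norm_sub_row_le _ _ hC hS X

/-- Column sums of the cutoff-`M` covariance on the `4M″` grid (`≤ a″ + a_S`). [cite: BenfattoGiulianiMastropietro2006, §2.8 (2.80)] -/
theorem colSum_gridSub_hubbardCovAboveCT_le_of_shell (h : M ≤ M'') (β μ hs : ℝ) (K : TrigPolyC4v) (Λ : ℝ) {a b : ℝ}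
    (hC : ∀ Y, ∑ X, ‖((hubbardGridSub L M'' β (2 * (2 * M''))).transpose * hubbardCovAboveCT L M'' β μ hs K Λ *
      hubbardGridSub L M'' β (2 * (2 * M''))) X Y‖ ≤ a)
    (hS : ∀ Y, ∑ X, ‖((hubbardGridSub L M'' β (2 * (2 * M''))).transpose * hubbardCovShellCT L h β μ hs K Λ *
      hubbardGridSub L M'' β (2 * (2 * M''))) X Y‖ ≤ b)
    (Y : GridLeg (GridPoint L (2 * (2 * M'')))) :
    ∑ X, ‖((hubbardGridSub L M β (2 * (2 * M''))).transpose * hubbardCovAboveCT L M β μ hs K Λ * hubbardGridSub L M β (2 * (2 * M''))) X Y‖ ≤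
      a + b := by
  rw [gridSub_hubbardCovAboveCT_eq_sub_shell h β μ hs K Λ]
  exact sum_norm_sub_col_le _ _ hC hS Y

end NormalForm

/-! ### §2 The determinant and Gram bounds along the interpolation -/

section Bounds

omit [NeZero L] in
/-- The interpolated weight is at most `1` (`0 ≤ t ≤ 1`, `w^K_Λ ∈ [0,1]`). [cite: Salmhofer1999, §4.2.5 (4.70)] -/
theorem twoCutoffWeight_le_one (h : M ≤ M'') (β μ : ℝ) (K : TrigPolyC4v) (Λ : ℝ) {t : ℝ} (ht0 : 0 ≤ t) (ht1 : t ≤ 1)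
    (k : FreqMomentum L M'') :
    hubbardCutoffWeightCT L M'' β μ K Λ k * (if k.1 ∈ MatsubaraIdx.shell h then t else 1) ≤ 1 := by
  have hw := salmhoferCutoff_mem_Icc ((matsubaraFreq β M'' k.1 ^ 2 + nambuXiCT L μ K k.2 ^ 2) / Λ ^ 2)
  have hw0 : 0 ≤ hubbardCutoffWeightCT L M'' β μ K Λ k := hw.1
  have hw1 : hubbardCutoffWeightCT L M'' β μ K Λ k ≤ 1 := hw.2
  split_ifs
  · nlinarith
  · rw [mul_one]; exact hw1

omit [NeZero L] in
/-- The infrared defect of the interpolated weight: `1 − v_t ≤ (1 − w^K_Λ) + [shell]` (`0 ≤ t`). [cite: PedraSalmhofer2008, §5 Lemma 5.1] -/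
theorem one_sub_twoCutoffWeight_le (h : M ≤ M'') (β μ : ℝ) (K : TrigPolyC4v) (Λ : ℝ) {t : ℝ} (ht0 : 0 ≤ t)
    (k : FreqMomentum L M'') :
    1 - hubbardCutoffWeightCT L M'' β μ K Λ k * (if k.1 ∈ MatsubaraIdx.shell h then t else 1) ≤
      (1 - hubbardCutoffWeightCT L M'' β μ K Λ k) + (if k.1 ∈ MatsubaraIdx.shell h then 1 else 0) := by
  have hw := salmhoferCutoff_mem_Icc ((matsubaraFreq β M'' k.1 ^ 2 + nambuXiCT L μ K k.2 ^ 2) / Λ ^ 2)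
  have hw0 : 0 ≤ hubbardCutoffWeightCT L M'' β μ K Λ k := hw.1
  have hw1 : hubbardCutoffWeightCT L M'' β μ K Λ k ≤ 1 := hw.2
  split_ifs
  · nlinarith
  · rw [mul_one, add_zero]

/-- **The infrared constant of the interpolated weight**: `(βL²)⁻¹Σ(1 − v_t)/√(ω² + e_K²) ≤ κ² + 2(M″−M)/(π(2M+1))` whenever
`(βL²)⁻¹Σ(1 − w^K_Λ)/√(ω² + e_K²) ≤ κ²` — the shell costs its Fourier–Gram sum. [cite: PedraSalmhofer2008, §5 Lemma 5.1] -/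
theorem infraredSum_twoCutoffWeight_le {β : ℝ} (hβ : 0 < β) (h : M ≤ M'') (μ : ℝ) (K : TrigPolyC4v) (Λ : ℝ) {t : ℝ} (ht0 : 0 ≤ t)
    {κ : ℝ}
    (hIR : 1 / (β * (L : ℝ) ^ 2) * ∑ k : FreqMomentum L M'',
        (1 - hubbardCutoffWeightCT L M'' β μ K Λ k) / Real.sqrt (matsubaraFreq β M'' k.1 ^ 2 + nambuXiCT L μ K k.2 ^ 2) ≤ κ ^ 2) :
    1 / (β * (L : ℝ) ^ 2) * ∑ k : FreqMomentum L M'',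
        (1 - hubbardCutoffWeightCT L M'' β μ K Λ k * (if k.1 ∈ MatsubaraIdx.shell h then t else 1)) /
          Real.sqrt (matsubaraFreq β M'' k.1 ^ 2 + nambuXiCT L μ K k.2 ^ 2) ≤
      κ ^ 2 + 2 * ((M'' : ℝ) - M) / (Real.pi * (2 * M + 1)) := by
  have hL : (0 : ℝ) < L := by exact_mod_cast Nat.pos_of_ne_zero (NeZero.ne L)
  have hβL : (0 : ℝ) < β * (L : ℝ) ^ 2 := by positivity
  have hνne : ∀ j : MatsubaraIdx M'', matsubaraFreq β M'' j ≠ 0 := fun j => matsubaraFreq_ne_zero hβ.ne' j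
  -- pointwise: `(1 - v_t)/√ ≤ (1 - w)/√ + [shell]/|ν|`
  have hpt : ∀ k : FreqMomentum L M'',
      (1 - hubbardCutoffWeightCT L M'' β μ K Λ k * (if k.1 ∈ MatsubaraIdx.shell h then t else 1)) /
          Real.sqrt (matsubaraFreq β M'' k.1 ^ 2 + nambuXiCT L μ K k.2 ^ 2) ≤
        (1 - hubbardCutoffWeightCT L M'' β μ K Λ k) / Real.sqrt (matsubaraFreq β M'' k.1 ^ 2 + nambuXiCT L μ K k.2 ^ 2) +
          (if k.1 ∈ MatsubaraIdx.shell h then 1 / |matsubaraFreq β M'' k.1| else 0) := by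
    intro k
    have hsq : 0 < Real.sqrt (matsubaraFreq β M'' k.1 ^ 2 + nambuXiCT L μ K k.2 ^ 2) :=
      Real.sqrt_pos.2 (lt_of_lt_of_le (pow_pos (abs_pos.2 (hνne k.1)) 2)
        (by rw [sq_abs]; exact le_add_of_nonneg_right (sq_nonneg _)))
    have hle := one_sub_twoCutoffWeight_le h β μ K Λ ht0 k
    have hdiv := div_le_div_of_nonneg_right hle hsq.le
    refine hdiv.trans ?_
    rw [add_div]
    refine add_le_add le_rfl ?_
    split_ifs with hk
    · rw [one_div_le_one_div hsq (abs_pos.2 (hνne k.1)), ← Real.sqrt_sq_eq_abs]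
      exact Real.sqrt_le_sqrt (le_add_of_nonneg_right (sq_nonneg _))
    · rw [zero_div]
  -- the shell sum
  have hshell : ∑ k : FreqMomentum L M'', (if k.1 ∈ MatsubaraIdx.shell h then 1 / |matsubaraFreq β M'' k.1| else (0 : ℝ)) ≤
      (L : ℝ) ^ 2 * (2 * ((M'' : ℝ) - M) * (β / (Real.pi * (2 * M + 1)))) := by
    rw [Fintype.sum_prod_type, sum_comm]
    have hcard : (Fintype.card (TorusSite 2 L) : ℝ) = (L : ℝ) ^ 2 := by
      rw [Fintype.card_pi, Fin.prod_const, ZMod.card]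
      push_cast
      ring
    have hinner : ∀ kv : TorusSite 2 L,
        ∑ j : MatsubaraIdx M'', (if j ∈ MatsubaraIdx.shell h then 1 / |matsubaraFreq β M'' j| else (0 : ℝ)) ≤
          2 * ((M'' : ℝ) - M) * (β / (Real.pi * (2 * M + 1))) := by
      intro kv
      rw [← sum_filter, Finset.filter_mem_eq_inter, Finset.univ_inter]
      exact sum_shell_one_div_abs_le hβ h
    calc ∑ kv : TorusSite 2 L, ∑ j : MatsubaraIdx M'', (if j ∈ MatsubaraIdx.shell h then 1 / |matsubaraFreq β M'' j| else (0 : ℝ))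
        ≤ ∑ _kv : TorusSite 2 L, 2 * ((M'' : ℝ) - M) * (β / (Real.pi * (2 * M + 1))) := sum_le_sum fun kv _ => hinner kv
      _ = (L : ℝ) ^ 2 * (2 * ((M'' : ℝ) - M) * (β / (Real.pi * (2 * M + 1)))) := by
          rw [sum_const, card_univ, nsmul_eq_mul, hcard]
  have hsum := sum_le_sum fun k (_ : k ∈ (univ : Finset (FreqMomentum L M''))) => hpt k
  rw [sum_add_distrib] at hsum
  have hM1 : (0 : ℝ) < Real.pi * (2 * M + 1) := by positivity
  calc 1 / (β * (L : ℝ) ^ 2) * ∑ k : FreqMomentum L M'',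
        (1 - hubbardCutoffWeightCT L M'' β μ K Λ k * (if k.1 ∈ MatsubaraIdx.shell h then t else 1)) /
          Real.sqrt (matsubaraFreq β M'' k.1 ^ 2 + nambuXiCT L μ K k.2 ^ 2)
      ≤ 1 / (β * (L : ℝ) ^ 2) * (∑ k : FreqMomentum L M'',
          (1 - hubbardCutoffWeightCT L M'' β μ K Λ k) / Real.sqrt (matsubaraFreq β M'' k.1 ^ 2 + nambuXiCT L μ K k.2 ^ 2) +
          (L : ℝ) ^ 2 * (2 * ((M'' : ℝ) - M) * (β / (Real.pi * (2 * M + 1))))) :=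
        mul_le_mul_of_nonneg_left (hsum.trans (add_le_add le_rfl hshell)) (by positivity)
    _ = 1 / (β * (L : ℝ) ^ 2) * ∑ k : FreqMomentum L M'',
          (1 - hubbardCutoffWeightCT L M'' β μ K Λ k) / Real.sqrt (matsubaraFreq β M'' k.1 ^ 2 + nambuXiCT L μ K k.2 ^ 2) +
          2 * ((M'' : ℝ) - M) / (Real.pi * (2 * M + 1)) := by
        rw [mul_add]
        congr 1
        field_simp
    _ ≤ κ ^ 2 + 2 * ((M'' : ℝ) - M) / (Real.pi * (2 * M + 1)) := add_le_add hIR le_rfl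

/-- **THE DETERMINANT BOUND ALONG THE TWO-CUTOFF INTERPOLATION, uniformly in `t ∈ [0,1]`**: for `0 < β`, cutoffs `M ≤ M″` (`0 < M″`), a frame `K`,
zero seed, and any `κ` with `(βL²)⁻¹Σ(1 − w^K_Λ)/√(ω² + e_K²) ≤ κ²` at cutoff `M″`, the interpolated grid covariance on the `4M″` grid satisfies
`IsDetBoundedR q (Sᵀ C^K_{>Λ} S + t·S″ᵀ S_shell S″) √(2(7 + κ² + 2(M″−M)/(π(2M+1))))` (charge-`0` legs as rows). [cite: PedraSalmhofer2008, Thm 1.3] -/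
theorem isDetBoundedR_gridSub_twoCutoff {β : ℝ} (hβ : 0 < β) (h : M ≤ M'') [NeZero M''] (μ : ℝ) (K : TrigPolyC4v) (Λ : ℝ) {t : ℝ}
    (ht0 : 0 ≤ t) (ht1 : t ≤ 1) {κ : ℝ}
    (hIR : 1 / (β * (L : ℝ) ^ 2) * ∑ k : FreqMomentum L M'',
        (1 - hubbardCutoffWeightCT L M'' β μ K Λ k) / Real.sqrt (matsubaraFreq β M'' k.1 ^ 2 + nambuXiCT L μ K k.2 ^ 2) ≤ κ ^ 2) :
    IsDetBoundedR (fun X : GridLeg (GridPoint L (2 * (2 * M''))) => decide (X.2 = 0))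
      ((hubbardGridSub L M β (2 * (2 * M''))).transpose * hubbardCovAboveCT L M β μ 0 K Λ * hubbardGridSub L M β (2 * (2 * M'')) +
        t • ((hubbardGridSub L M'' β (2 * (2 * M''))).transpose * hubbardCovShellCT L h β μ 0 K Λ *
          hubbardGridSub L M'' β (2 * (2 * M''))))
      (Real.sqrt (2 * (7 + (κ ^ 2 + 2 * ((M'' : ℝ) - M) / (Real.pi * (2 * M + 1)))))) := by
  have hc0 : 0 ≤ κ ^ 2 + 2 * ((M'' : ℝ) - M) / (Real.pi * (2 * M + 1)) := by
    have hMM : (M : ℝ) ≤ M'' := by exact_mod_cast h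
    have : 0 ≤ 2 * ((M'' : ℝ) - M) / (Real.pi * (2 * M + 1)) := div_nonneg (by linarith) (by positivity)
    positivity
  have hIR' := infraredSum_twoCutoffWeight_le hβ h μ K Λ ht0 hIR
  rw [← Real.sq_sqrt hc0] at hIR'
  have hdet := isDetBoundedR_gridSub_normalCovariance_weighted (L := L) (M := M'') hβ μ K
    (fun k => hubbardCutoffWeightCT L M'' β μ K Λ k * (if k.1 ∈ MatsubaraIdx.shell h then t else 1))
    (fun k => twoCutoffWeight_le_one h β μ K Λ ht0 ht1 k) hIR'
  rw [Real.sq_sqrt hc0] at hdet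
  rw [gridSub_hubbardCovAboveCT_add_smul_shell_eq h β μ K Λ t]
  exact hdet

/-- Equal charge flags mean equal charges. [folklore] -/
private theorem charge_eq_of_decide_eq_tc {P : Type*} {X Y : GridLeg P} (hq : decide (X.2 = 0) = decide (Y.2 = 0)) : X.2 = Y.2 := by
  rcases Fin.exists_fin_two.1 ⟨X.2, rfl⟩ with hX | hX <;> rcases Fin.exists_fin_two.1 ⟨Y.2, rfl⟩ with hY | hY <;> simp_all

/-- **The charge hypothesis** for the interpolated covariance: it vanishes between legs of equal charge. [cite: BenfattoGiulianiMastropietro2006, §2.8 (2.80)] -/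
theorem gridSub_twoCutoff_apply_of_charge_eq (h : M ≤ M'') (β μ : ℝ) (K : TrigPolyC4v) (Λ : ℝ) (t : ℝ)
    {X Y : GridLeg (GridPoint L (2 * (2 * M'')))} (hXY : X.2 = Y.2) :
    ((hubbardGridSub L M β (2 * (2 * M''))).transpose * hubbardCovAboveCT L M β μ 0 K Λ * hubbardGridSub L M β (2 * (2 * M'')) +
        t • ((hubbardGridSub L M'' β (2 * (2 * M''))).transpose * hubbardCovShellCT L h β μ 0 K Λ *
          hubbardGridSub L M'' β (2 * (2 * M'')))) X Y = 0 := by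
  rw [gridSub_hubbardCovAboveCT_add_smul_shell_eq h β μ K Λ t]
  simp only [hubbardGridSub]
  exact gridSub_pullback_normalCovariance_apply_of_charge_eq β _ _ _ hXY

/-- **THE GRAM BOUND ALONG THE TWO-CUTOFF INTERPOLATION, uniformly in `t ∈ [0,1]`** — the literal covariance hypothesis `IsGramBoundedR` of the
Gram-bounded truncation / near-identity / response theorems for `𝒱_t = effAction (C_g + t·S_g) W`, with the `M`-, `t`-uniform constant
`√(2(7 + κ² + 2(M″−M)/(π(2M+1))))`. [cite: PedraSalmhofer2008, Thm 1.3] -/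
theorem isGramBoundedR_gridSub_twoCutoff {β : ℝ} (hβ : 0 < β) (h : M ≤ M'') [NeZero M''] (μ : ℝ) (K : TrigPolyC4v) (Λ : ℝ) {t : ℝ}
    (ht0 : 0 ≤ t) (ht1 : t ≤ 1) {κ : ℝ}
    (hIR : 1 / (β * (L : ℝ) ^ 2) * ∑ k : FreqMomentum L M'',
        (1 - hubbardCutoffWeightCT L M'' β μ K Λ k) / Real.sqrt (matsubaraFreq β M'' k.1 ^ 2 + nambuXiCT L μ K k.2 ^ 2) ≤ κ ^ 2) :
    IsGramBoundedR
      ((hubbardGridSub L M β (2 * (2 * M''))).transpose * hubbardCovAboveCT L M β μ 0 K Λ * hubbardGridSub L M β (2 * (2 * M'')) +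
        t • ((hubbardGridSub L M'' β (2 * (2 * M''))).transpose * hubbardCovShellCT L h β μ 0 K Λ *
          hubbardGridSub L M'' β (2 * (2 * M''))))
      (Real.sqrt (2 * (7 + (κ ^ 2 + 2 * ((M'' : ℝ) - M) / (Real.pi * (2 * M + 1)))))) :=
  (isDetBoundedR_gridSub_twoCutoff hβ h μ K Λ ht0 ht1 hIR).isGramBoundedR
    (fun _ _ hq => gridSub_twoCutoff_apply_of_charge_eq h β μ K Λ t (charge_eq_of_decide_eq_tc hq)) (Real.sqrt_nonneg _)

/-- The dyadic form of the constant: for `M″ ≤ 2M` the shell term is below `1/π ≤ 1`, so the interpolated covariance is replica-Gram-bounded with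
`√(2(8 + κ²))`, uniformly in `t ∈ [0,1]` and in the cutoffs. [cite: PedraSalmhofer2008, Thm 1.3] -/
theorem isGramBoundedR_gridSub_twoCutoff_dyadic {β : ℝ} (hβ : 0 < β) (h : M ≤ M'') [NeZero M''] (hM2 : M'' ≤ 2 * M) (μ : ℝ)
    (K : TrigPolyC4v) (Λ : ℝ) {t : ℝ} (ht0 : 0 ≤ t) (ht1 : t ≤ 1) {κ : ℝ}
    (hIR : 1 / (β * (L : ℝ) ^ 2) * ∑ k : FreqMomentum L M'',
        (1 - hubbardCutoffWeightCT L M'' β μ K Λ k) / Real.sqrt (matsubaraFreq β M'' k.1 ^ 2 + nambuXiCT L μ K k.2 ^ 2) ≤ κ ^ 2) :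
    IsGramBoundedR
      ((hubbardGridSub L M β (2 * (2 * M''))).transpose * hubbardCovAboveCT L M β μ 0 K Λ * hubbardGridSub L M β (2 * (2 * M'')) +
        t • ((hubbardGridSub L M'' β (2 * (2 * M''))).transpose * hubbardCovShellCT L h β μ 0 K Λ *
          hubbardGridSub L M'' β (2 * (2 * M''))))
      (Real.sqrt (2 * (8 + κ ^ 2))) := by
  have hshell : 2 * ((M'' : ℝ) - M) / (Real.pi * (2 * M + 1)) ≤ 1 := by
    have hMM : (M'' : ℝ) ≤ 2 * M := by exact_mod_cast hM2
    have hπ : (3 : ℝ) ≤ Real.pi := by linarith [Real.pi_gt_three]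
    have hden : (0 : ℝ) < Real.pi * (2 * M + 1) := by positivity
    rw [div_le_one hden]
    have hM0 : (0 : ℝ) ≤ M := Nat.cast_nonneg M
    nlinarith
  have h1 := isGramBoundedR_gridSub_twoCutoff hβ h μ K Λ ht0 ht1 hIR
  -- monotonicity of the Gram constant
  intro Γ' _ _ e n U hU N Z
  have hle : Real.sqrt (2 * (7 + (κ ^ 2 + 2 * ((M'' : ℝ) - M) / (Real.pi * (2 * M + 1))))) ≤ Real.sqrt (2 * (8 + κ ^ 2)) :=
    Real.sqrt_le_sqrt (by nlinarith)
  exact (h1 e n U hU N Z).trans (pow_le_pow_left₀ (Real.sqrt_nonneg _) hle N)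

end Bounds

/-! ### §3 (appended) Monotonicity of the Gram bound in the constant; the shell covariance with an `M`-uniform constant -/

section Mono

/-- **Gram-boundedness is monotone in the constant**: `IsGramBounded C κ → κ ≤ κ' → IsGramBounded C κ'` (`0 ≤ κ`). [cite: BenfattoGiulianiMastropietro2006, §2.8 (2.80)] -/
theorem IsGramBounded.mono {𝕜 : Type*} [RCLike 𝕜] {Γ : Type*} [Fintype Γ] [DecidableEq Γ] {C : Matrix Γ Γ 𝕜} {κ κ' : ℝ}
    (h : IsGramBounded C κ) (hκ : 0 ≤ κ) (hle : κ ≤ κ') : IsGramBounded C κ' :=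
  fun n U hU N Z => (h n U hU N Z).trans (pow_le_pow_left₀ hκ hle N)

universe v in
/-- **Replica-Gram-boundedness is monotone in the constant.** [cite: BenfattoGiulianiMastropietro2006, §2.8 (2.80)] -/
theorem IsGramBoundedR.mono {𝕜 : Type*} [RCLike 𝕜] {Γ : Type v} [Fintype Γ] [DecidableEq Γ] {C : Matrix Γ Γ 𝕜} {κ κ' : ℝ}
    (h : IsGramBoundedR C κ) (hκ : 0 ≤ κ) (hle : κ ≤ κ') : IsGramBoundedR C κ' :=
  fun _ _ _ e => (h e).mono hκ hle

/-- **The shell covariance on any grid is replica-Gram-bounded with the `M`-UNIFORM constant `1`** whenever `M″ ≤ 2M` (its own constant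
`√(2(M″−M)/(π(2M+1))) ≤ 1/√π`; for thin shells it is tiny, and the near-identity step's `θ = eα‖W‖_h/κ²` must then be run at a fixed constant).
[cite: PedraSalmhofer2008, §5 Lemma 5.1] -/
theorem isGramBoundedR_gridSub_hubbardCovShellCT_one {P : Type*} [Fintype P] [DecidableEq P] {β : ℝ} (hβ : 0 < β) (h : M ≤ M'') (hM2 : M'' ≤ 2 * M)
    (μ : ℝ) (K : TrigPolyC4v) (Λ : ℝ) (x : P → TorusSite 2 L) (τ : P → ℝ) :
    IsGramBoundedR ((gridSubMatrix L M'' β x τ).transpose * hubbardCovShellCT L h β μ 0 K Λ * gridSubMatrix L M'' β x τ) 1 := by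
  refine (isGramBoundedR_gridSub_hubbardCovShellCT hβ h μ K Λ x τ).mono (Real.sqrt_nonneg _) ?_
  rw [Real.sqrt_le_one (x := 2 * ((M'' : ℝ) - M) / (Real.pi * (2 * M + 1)))]
  have hMM : (M'' : ℝ) ≤ 2 * M := by exact_mod_cast hM2
  have hπ : (3 : ℝ) ≤ Real.pi := by linarith [Real.pi_gt_three]
  have hden : (0 : ℝ) < Real.pi * (2 * M + 1) := by positivity
  rw [div_le_one hden]
  have hM0 : (0 : ℝ) ≤ M := Nat.cast_nonneg M
  nlinarith

end Mono

end Literature.MathematicalPhysics.QuantumLattice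

end
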